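import Summits.AnomalousDissipation.AnomalousDissipation.Theses.KolmogorovPincer
import Summits.AnomalousDissipation.AnomalousDissipation.Theorems.KolmogorovPincerBesovSignalMeasurableTG
import Summits.AnomalousDissipation.AnomalousDissipation.Theorems.KolmogorovPincerKnownGradeRungTGTools
import Literature.Analysis.FluidPDE.DoeringFoiasProofs
import Literature.Analysis.FluidPDE.DoeringFoiasPowerProofs
import Literature.Analysis.FluidPDE.LerayHopfSpectralMeasurability
import Literature.Analysis.FluidPDE.LerayHopfUniformEnergyMomentum
import Literature.Analysis.FluidPDE.AlexakisDoeringInterpolation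
import Literature.Analysis.FluidPDE.LongTimeAverageNonneg
import Literature.Analysis.FluidPDE.LongTimeAverageSubadditive
import Literature.Analysis.FluidPDE.NSHopfEnergy
import Literature.Analysis.FunctionSpaces.BesovDifference
import Literature.Analysis.FunctionSpaces.TorusSobolevL6Spectral
import Literature.Analysis.FunctionSpaces.FlatTorus

/-!
# Support item `KolmogorovPincer.KnownGradeRungTG` (stmt-AnomalousDissipation-32781), proved

Route `KolmogorovPincer` (decomp-ad cell), Y-jaw ladder: RUNG 0, the KNOWN grade `7/8` — the BC5 rung of
the Y-jaw `KolmogorovCeilingTG` (claimed grade `1/4`; gap `ν^{5/8}` = the route's progress axis):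
`TaylorGreenForceRegularTG → RestMeanCeilingTG → BesovSignalMeasurableTG → KolmogorovCeilingSevenEighthsTG`,
i.e. modulo the (closed) force clauses, the open energy ceiling 24256 and the (closed, sibling file)
measurability support, EVERY global Leray–Hopf solution from rest at `f_TG` with `ν < min ν₀ 1` has the
`ν^{7/8}`-weighted Besov signal `ν^{7/8}[u(t)]²_{B^{1/2}_{8/3,∞}}` (a) finite a.e., (b) integrable on every
`(0,T]`, (c) with running time-means eventually `≤ M := 4(K+1)(‖f‖₂(E+1)^{1/2} + (E+1))`.
Proof: the slice bound `ν^{7/8}[v]² ≤ 4(K+1)(ν‖∇v‖₂² + ‖v‖₂²)` (tools file: `‖δ_h v‖_{8/3} ≤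
‖δ_h v‖₂^{5/8}‖δ_h v‖₆^{3/8}`, `H¹ ⊂ B¹_{2,∞}`, `H¹(T³) ⊂ L⁶`), domination for (b), and for (c) the
from-rest dissipation-mean bound `⟨ν‖∇u‖²⟩_T ≤ ‖f‖₂⟨‖u‖₂²⟩_T^{1/2}` with the energy ceiling
`limsup ⟨‖u‖₂²⟩_T ≤ E`.  Ported by name from the decomp-ad lens-1 g14 node file `CeilingLadder.lean` (v2,
kernel-checked 2026-08-30); landed by the cell's prover seat.  Nothing here proves the summit or either jaw.
References: Triebel 1983 §2.5.12; DiPerna–Lions 1989 Lemma II.1; Doering–Foias 2002 §2. [folklore]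
-/

set_option linter.dupNamespace false

noncomputable section

namespace Summit.AnomalousDissipation.AnomalousDissipation.Theorems.KolmogorovPincerKnownGradeRungTG

open scoped BigOperators Topology Classical MeasureTheory InnerProductSpace
open Filter Set Function TopologicalSpace MeasureTheory
open scoped ENNReal
open Literature.Analysis.FunctionSpaces Literature.Analysis.FluidPDE
open Summit.AnomalousDissipation.AnomalousDissipation.Theses
open Summit.AnomalousDissipation.AnomalousDissipation.Theorems.KolmogorovPincerBesovSignalMeasurableTG
  (ae_memLp_of_isLerayHopfOn)
open Summit.AnomalousDissipation.AnomalousDissipation.Theorems.KolmogorovPincerKnownGradeRungTGTools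

/-- **Route decl `KolmogorovPincer.KnownGradeRungTG` (stmt-AnomalousDissipation-32781), proved**: RUNG 0
(the KNOWN grade `7/8`) of the Y-jaw ladder, with the explicit ceiling
`M = 4(K+1)·(‖f‖₂ (E+1)^{1/2} + (E+1))` for `ν < min ν₀ 1`. [folklore] -/
theorem kolmogorovPincer_knownGradeRungTG : KolmogorovPincer.KnownGradeRungTG := by
  intro hF hC hS f hf
  obtain ⟨hfs, -, hfz⟩ := hF f hf
  have hf2 : MemLp f 2 volume := hfs.memLp 2
  obtain ⟨K, hK⟩ := Torus.exists_eLpNorm_six_le_eSobolevNorm_one (d := Fin 3) (by simp)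
  obtain ⟨E, ν₀', hν₀', hCν⟩ := hC f hf
  set Bf : ℝ := Real.sqrt (∫ x, ‖f x‖ ^ 2) * Real.sqrt (E + 1) with hBf
  have hBf0 : 0 ≤ Bf := by positivity
  set CK : ℝ := 4 * ((K : ℝ) + 1) with hCK
  have hCK0 : 0 ≤ CK := by positivity
  refine ⟨CK * (Bf + (E + 1)), min ν₀' 1, lt_min hν₀' one_pos, ?_⟩
  intro ν hν hνlt u hu
  have hν1 : ν ≤ 1 := le_of_lt (lt_of_lt_of_le hνlt (min_le_right _ _))
  have hEν : meanEnergy u ≤ E := hCν ν hν (lt_of_lt_of_le hνlt (min_le_left _ _)) u hu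
  -- signals
  set Y : ℝ → ℝ := fun t => ν ^ (7 / 8 : ℝ) *
    ((eBesovSupSeminorm (1 / 2 : ℝ) (8 / 3 : ENNReal) (u t) volume) ^ 2).toReal with hYdef
  set D : ℝ → ℝ := fun t => ν * (Torus.eGradNormSq (u t)).toReal with hDdef
  set Esig : ℝ → ℝ := fun t => ∫ x, ‖u t x‖ ^ 2 with hEsig
  have hY0 : ∀ t, 0 ≤ Y t := fun t => by positivity
  have hD0 : ∀ t, 0 ≤ D t := fun t => by positivity
  have hE0 : ∀ t, 0 ≤ Esig t := fun t => integral_nonneg fun x => by positivity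
  set g : ℝ → ℝ := fun t => CK * (D t + Esig t) with hgdef
  have hg0 : ∀ t, 0 ≤ g t := fun t => mul_nonneg hCK0 (add_nonneg (hD0 t) (hE0 t))
  -- slice facts on (0, T]
  have hGfin : ∀ T, 0 < T → ∀ᵐ t ∂(volume.restrict (Set.Ioc 0 T)), Torus.eGradNormSq (u t) < ⊤ := by
    intro T hT
    have hLH := hu T hT
    have h1 : ∀ᵐ t ∂(volume.restrict (Set.Ioo 0 T)), Torus.eGradNormSq (u t) < ⊤ :=
      ae_lt_top' hLH.aemeasurable_eGradNormSq hLH.lintegral_eGradNormSq_lt_top.ne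
    rw [← Measure.restrict_congr_set (Ioo_ae_eq_Ioc (μ := (volume : Measure ℝ)) (a := 0) (b := T))]
    exact h1
  have hHfin : ∀ T, 0 < T → ∀ᵐ t ∂(volume.restrict (Set.Ioc 0 T)),
      Torus.MemSobolev 1 (EuclideanSpace.complexify ∘ u t) := by
    intro T hT
    have h1 := (hu T hT).memL2Sobolev.1
    rw [← Measure.restrict_congr_set (Ioo_ae_eq_Ioc (μ := (volume : Measure ℝ)) (a := 0) (b := T))]
    exact h1
  have hmemT : ∀ T : ℝ, ∀ᵐ t ∂(volume.restrict (Set.Ioc 0 T)), t ∈ Set.Ioc 0 T :=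
    fun T => ae_restrict_mem measurableSet_Ioc
  have hdom : ∀ T, 0 < T → ∀ᵐ t ∂(volume.restrict (Set.Ioc 0 T)), Y t ≤ g t := by
    intro T hT
    filter_upwards [hGfin T hT, hHfin T hT, hmemT T] with t hGt hHt htmem
    have hv2 := hu.memLp_two htmem.1.le
    have h6 := hK (u t) hHt
    have := seven_eighths_le_real hν hν1 hv2 hGt hHt.eSobolevNorm_lt_top h6.2
    simpa only [hgdef, hDdef, hEsig, hYdef, hCK] using this
  have hDi : ∀ T, 0 < T → IntegrableOn D (Set.Ioc 0 T) := fun T hT =>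
    (intervalIntegrable_iff_integrableOn_Ioc_of_le hT.le).1 ((hu T hT).intervalIntegral_dissipation_eq hT).1
  have hEi : ∀ T, 0 < T → IntegrableOn Esig (Set.Ioc 0 T) := fun T hT =>
    hu.integrableOn_integral_norm_sq hT
  have hgi : ∀ T, 0 < T → IntegrableOn g (Set.Ioc 0 T) := fun T hT =>
    ((hDi T hT).add (hEi T hT)).const_mul CK
  refine ⟨?_, ?_, ?_⟩
  · -- (a) finiteness a.e. on (0, ∞)
    have hG := ae_eGradNormSq_lt_top_Ioi hu
    have h6 : ∀ᵐ t ∂(volume.restrict (Set.Ioi (0 : ℝ))), MemLp (u t) 6 volume := by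
      rw [Torus.Ioi_zero_eq_iUnion_Ioo_nat, ae_restrict_iUnion_iff]
      intro n
      rcases Nat.eq_zero_or_pos n with hn | hn
      · subst hn; simp
      · exact ae_memLp_of_isLerayHopfOn (hu n (by exact_mod_cast hn)) le_rfl
    have hmem : ∀ᵐ t ∂(volume.restrict (Set.Ioi (0 : ℝ))), t ∈ Set.Ioi (0 : ℝ) :=
      ae_restrict_mem measurableSet_Ioi
    filter_upwards [hG, h6, hmem] with t hGt h6t ht
    have hv2 := hu.memLp_two (le_of_lt ht)
    have h8 := eBesovSupSeminorm_half_pow_eight_le_lsix hv2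
    have hfin : (3 * Torus.eGradNormSq (u t)) ^ 2 * (2 * eLpNorm (u t) 2 volume) *
        (2 * eLpNorm (u t) 6 volume) ^ 3 < ⊤ :=
      (ENNReal.mul_ne_top (ENNReal.mul_ne_top (ENNReal.pow_ne_top (ENNReal.mul_ne_top (by norm_num) hGt.ne))
        (ENNReal.mul_ne_top (by norm_num) hv2.eLpNorm_lt_top.ne))
        (ENNReal.pow_ne_top (ENNReal.mul_ne_top (by norm_num) h6t.eLpNorm_lt_top.ne))).lt_top
    have h8' := lt_of_le_of_lt h8 hfin
    by_contra htop
    rw [not_lt, top_le_iff] at htop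
    rw [htop, ENNReal.top_pow (by norm_num)] at h8'
    exact lt_irrefl _ h8'
  · -- (b) integrability on (0, T] by domination
    intro T hT
    have hYm : AEStronglyMeasurable Y (volume.restrict (Set.Ioc 0 T)) := by
      have h1 : AEStronglyMeasurable (fun t =>
          ((eBesovSupSeminorm (1 / 2 : ℝ) (8 / 3 : ENNReal) (u t) volume) ^ 2).toReal)
          (volume.restrict (Set.Ioc 0 T)) :=
        (hS f hf ν hν u hu).mono_measure
          (Measure.restrict_mono (Set.Ioc_subset_Ioi_self : Set.Ioc (0 : ℝ) T ⊆ Set.Ioi 0) le_rfl)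
      exact h1.const_mul (ν ^ (7 / 8 : ℝ))
    refine Integrable.mono' (hgi T hT) hYm ?_
    filter_upwards [hdom T hT] with t ht
    rw [Real.norm_of_nonneg (hY0 t)]
    exact ht
  · -- (c) eventual bound of the running means, uniformly in ν
    have hbdd := hu.isBoundedUnder_timeMean_energy hν hf2 hfz
    have hlim : limsup (timeMean Esig) atTop < E + 1 := by
      have : longTimeAvgSup Esig ≤ E := hEν
      unfold longTimeAvgSup at this
      linarith
    have hev : ∀ᶠ T in atTop, timeMean Esig T < E + 1 := eventually_lt_of_limsup_lt hlim hbdd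
    obtain ⟨T₁, hT₁⟩ := Filter.eventually_atTop.1 hev
    refine ⟨max T₁ 1, fun T hT => ?_⟩
    have hTT₁ : T₁ ≤ T := le_trans (le_max_left _ _) hT
    have hT1 : 1 ≤ T := le_trans (le_max_right _ _) hT
    have hT0 : 0 < T := by linarith
    have hEmean : timeMean Esig T ≤ E + 1 := le_of_lt (hT₁ T hTT₁)
    have hDmean : timeMean D T ≤ Bf := by
      have h1 := timeMean_dissipation_le_of_rest hfs hu hT0
      have h2 : Real.sqrt (timeMean Esig T) ≤ Real.sqrt (E + 1) := Real.sqrt_le_sqrt hEmean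
      calc timeMean D T ≤ Real.sqrt (∫ x, ‖f x‖ ^ 2) * Real.sqrt (timeMean Esig T) := h1
        _ ≤ Real.sqrt (∫ x, ‖f x‖ ^ 2) * Real.sqrt (E + 1) := by gcongr
    have hYg : timeMean Y T ≤ timeMean g T := by
      by_cases hYi : IntegrableOn Y (Set.Ioc 0 T)
      · unfold timeMean
        rw [intervalIntegral.integral_of_le hT0.le, intervalIntegral.integral_of_le hT0.le]
        exact mul_le_mul_of_nonneg_left (integral_mono_ae hYi (hgi T hT0) (hdom T hT0))
          (inv_nonneg.2 hT0.le)
      · have h0 : timeMean Y T = 0 := by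
          unfold timeMean
          rw [intervalIntegral.integral_of_le hT0.le, integral_undef hYi, mul_zero]
        rw [h0]
        exact timeMean_nonneg hg0 hT0.le
    have hgmean : timeMean g T = CK * (timeMean D T + timeMean Esig T) := by
      have h1 := timeMean_add (f := D) (g := Esig) hT0.le (hDi T hT0) (hEi T hT0)
      rw [← h1]
      exact timeMean_const_mul CK (fun t => D t + Esig t) T
    calc timeMean Y T ≤ timeMean g T := hYg
      _ = CK * (timeMean D T + timeMean Esig T) := hgmean
      _ ≤ CK * (Bf + (E + 1)) := by gcongr


end Summit.AnomalousDissipation.AnomalousDissipation.Theorems.KolmogorovPincerKnownGradeRungTG
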